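import Summits.CriticalPhenomena.CardyFormulaZ2.Theorems.CardyComplexConeParafermionToSLESixFamiliesDiamondTraceBlock
import HarnessLib
import Literature.Probability.LatticeModels.MedialWindingBridge

/-!
# From a deterministic winding to the value of the corner observable: `E(u, f) = e^{-iπT/6} · P(passage)`
# (line `potential-darboux-picard-diamond`, S1′: the cone factor at boundary darts)

Crux `ParafermionToSLESixFamilies` (stmt-CriticalPhenomena-11389), line `potential-darboux-picard-diamond`, stub
`stub_exactPotentialTracePh` (S1′), clauses (DIR)/(LOW). The corner observable `cornerObs E δ u (faceAt u j)` is the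
expectation of the phase `exp(-i W/3)` of the winding `W = (π/2) · turnCount` of the exploration at its (at most one)
passage through the corner `(u, j)` (`cornerObs_integrand_eq`, `…DiamondTraceBlock.lean`). At a boundary dart the
winding is DETERMINISTIC (`Literature/…/MedialExplorationVertexEscape.lean`: `turnCount = T` at every passage, whatever
the configuration). This file turns that into the value of the observable:

* `cornerObs_eq_phase_mul_real_passes` — if `turnCount = T` at every passage of `(u, j)` before the exit, then
  `cornerObs E δ u (faceAt u j) = exp(-iπT/6) · P(the exploration passes (u, faceAt u j))`;
* `cornerObs_eq_phase_mul_touchProb` (registered, `--supports` the crux) — at a TOUCH corner (the face is inner with a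
  corner on the dual-wired arc) and under the connectivity hypotheses (H1) `A` connected through `Ω_δ`, (H2) `B`
  lattice-connected of `passesCorner_iff_reachable_of_touch`:
  `cornerObs E E.δ u (faceAt u j) = exp(-iπT/6) · touchProb E u` — modulus the monotone touch probability, phase the
  deterministic cone factor (Duminil-Copin 2013, Prop. 5 with the phase made explicit).

Combined with `exactPair_chainIncrement` this is the exact block of the boundary trace:
`Ψ (faceAt u (j+2)) - Ψ (faceAt u j) = √3 · P(u ↔ A) · i^j e^{-iπ(T+1)/6}`.
-/

noncomputable section

namespace Summit.CriticalPhenomena.CardyFormulaZ2.Cruxes.ParafermionToSLESixFamilies.PotentialDarbouxPicardDiamond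

open scoped BigOperators
open MeasureTheory Filter Set Complex
open Literature.Probability Literature.Probability.LatticeModels Literature.Probability.Percolation
open Literature.Probability.LatticeModels.DiscreteDobrushin
open Literature.Probability.RandomPlanarGeometry
open Summit.CriticalPhenomena.CardyFormulaZ2.Cruxes.EdgePrecompact.QkzStripBoundaryArm (cornerObs)
open Summit.CriticalPhenomena.CardyFormulaZ2.Cruxes.ParafermionToSLESixFamilies.IicTraceFluxPairing
  (passesCornerAt_iff_cornerOrbit_eq passesCorner_iff_exists_cornerOrbit_eq measurableSet_passesCorner
    real_passesCorner_eq_touchProb touchProb)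

variable {E : DiscreteDobrushin}

/-- **The integrand of the corner observable under a deterministic winding** is the phase times the indicator of the
passage event: at most one orbit time carries the corner, and its turn count is `T`. -/
theorem cornerObs_integrand_eq_phase_indicator (hE : E.IsZdAdmissible) {δ : ℝ} (hδ : δ ≠ 0) {u : Site 2} {j : Fin 4}
    {T : ℤ} (hT : ∀ (ω : BondConfig (Site 2)) (t : ℕ), t < exitTime hE ω →
      cornerOrbit (E.bcBondConfig ω) (startCorner hE) t = (u, j) → turnCount (E.bcBondConfig ω) (startCorner hE) t = T)
    (ω : BondConfig (Site 2)) :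
    (∑ k ∈ (Finset.range (medialExploration E ω).length).filter (fun k =>
        (medialExploration E ω)[k]? = some (cornerSource u (faceAt u j)) ∧
          (medialExploration E ω)[k + 1]? = some (cornerTarget u (faceAt u j))),
        Complex.exp (-(Complex.I / 3) * ((Literature.Probability.LatticeModels.Polyline.winding
          (((medialExploration E ω).map (medialPoint δ)).take (k + 2)) : ℝ) : ℂ))) =
      {ω : BondConfig (Site 2) | ∃ k : ℕ, (medialExploration E ω)[k]? = some (cornerSource u (faceAt u j)) ∧
          (medialExploration E ω)[k + 1]? = some (cornerTarget u (faceAt u j))}.indicator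
        (fun _ => Complex.exp (-(Real.pi / 6 * T : ℝ) * I)) ω := by
  rw [cornerObs_integrand_eq hE hδ u j ω]
  set F := (Finset.range (exitTime hE ω)).filter
    (fun k => cornerOrbit (E.bcBondConfig ω) (startCorner hE) k = (u, j)) with hF
  -- every summand is the constant phase
  have hconst : ∀ k ∈ F, Complex.exp (-(Real.pi / 6 * turnCount (E.bcBondConfig ω) (startCorner hE) k : ℝ) * I) =
      Complex.exp (-(Real.pi / 6 * T : ℝ) * I) := by
    intro k hk
    rw [hF, Finset.mem_filter, Finset.mem_range] at hk
    rw [hT ω k hk.1 hk.2]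
  rw [Finset.sum_congr rfl hconst, Finset.sum_const, nsmul_eq_mul]
  -- the filter has at most one element, and is nonempty iff the corner is passed
  have hcard : F.card ≤ 1 := by
    refine Finset.card_le_one.2 fun a ha b hb => ?_
    rw [hF, Finset.mem_filter, Finset.mem_range] at ha hb
    by_contra hne
    rcases Nat.lt_or_gt_of_ne hne with h | h
    · exact cornerOrbit_ne hE (isStartCorner_startCorner hE) h
        (fun i hi => isInnerFace_of_lt_exitTime hE ω (lt_trans hi hb.1)) (ha.2.trans hb.2.symm)
    · exact cornerOrbit_ne hE (isStartCorner_startCorner hE) h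
        (fun i hi => isInnerFace_of_lt_exitTime hE ω (lt_trans hi ha.1)) (hb.2.trans ha.2.symm)
  by_cases hω : ω ∈ {ω : BondConfig (Site 2) | ∃ k : ℕ,
      (medialExploration E ω)[k]? = some (cornerSource u (faceAt u j)) ∧
        (medialExploration E ω)[k + 1]? = some (cornerTarget u (faceAt u j))}
  · rw [Set.indicator_of_mem hω]
    obtain ⟨k, hk, hkq⟩ := (passesCorner_iff_exists_cornerOrbit_eq hE ω u j).1 hω
    have hkF : k ∈ F := by rw [hF, Finset.mem_filter, Finset.mem_range]; exact ⟨hk, hkq⟩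
    have h1 : F.card = 1 := le_antisymm hcard (Finset.card_pos.2 ⟨k, hkF⟩)
    rw [h1, Nat.cast_one, one_mul]
  · rw [Set.indicator_of_notMem hω]
    have h0 : F = ∅ := by
      refine Finset.eq_empty_of_forall_notMem fun k hk => hω ?_
      rw [hF, Finset.mem_filter, Finset.mem_range] at hk
      exact (passesCorner_iff_exists_cornerOrbit_eq hE ω u j).2 ⟨k, hk.1, hk.2⟩
    rw [h0, Finset.card_empty, Nat.cast_zero, zero_mul]

/-- **The corner observable under a deterministic winding**: `E(u, faceAt u j) = exp(-iπT/6) · P(passage)`. -/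
theorem cornerObs_eq_phase_mul_real_passes (hE : E.IsZdAdmissible) {δ : ℝ} (hδ : δ ≠ 0) {u : Site 2} {j : Fin 4}
    {T : ℤ} (hT : ∀ (ω : BondConfig (Site 2)) (t : ℕ), t < exitTime hE ω →
      cornerOrbit (E.bcBondConfig ω) (startCorner hE) t = (u, j) → turnCount (E.bcBondConfig ω) (startCorner hE) t = T) :
    cornerObs E δ u (faceAt u j) = Complex.exp (-(Real.pi / 6 * T : ℝ) * I) *
      (bondPercolation (zdGraph 2) half).real
        {ω : BondConfig (Site 2) | ∃ k : ℕ, (medialExploration E ω)[k]? = some (cornerSource u (faceAt u j)) ∧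
          (medialExploration E ω)[k + 1]? = some (cornerTarget u (faceAt u j))} := by
  have hS := measurableSet_passesCorner E u (faceAt u j)
  unfold cornerObs
  -- buildfix 2026-08-20 (proof-only, regime-robust): `cornerObs` spells the fully-qualified
  -- `Literature.Probability.LatticeModels.winding` (= `FermionicObservable`'s copy whenever that module is in
  -- the closure); realign it with the `Polyline.winding` of this file's lemmas (`MedialWindingBridge`; a
  -- syntactic identity once the Literature dedupe lands).
  rw [← Literature.Probability.LatticeModels.Polyline.winding_eq_winding']
  simp only
  rw [show (fun ω : BondConfig (Site 2) => _) = _ from funext (cornerObs_integrand_eq_phase_indicator hE hδ hT),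
    integral_indicator hS, setIntegral_const, Measure.real, Complex.real_smul, mul_comm]

/-- **The corner observable at a touch corner with a deterministic winding** (registered helper of
`stub_exactPotentialTracePh`): under (H1) the wired arc is connected through `Ω_δ` and (H2) the dual-wired arc is
lattice-connected, at a corner `(u, faceAt u j)` whose face is inner with a corner on the dual-wired arc, and whose winding
is `T` at every passage, `cornerObs E E.δ u (faceAt u j) = exp(-iπT/6) · touchProb E u`. -/
theorem cornerObs_eq_phase_mul_touchProb : ∀ (E : DiscreteDobrushin) (hE : E.IsZdAdmissible), ((discreteDomainGraph E.Ω E.δ).induce E.zdArcA).Preconnected → ((zdGraph 2).induce E.zdArcB).Preconnected → ∀ (u : Site 2) (j : Fin 4) (T : ℤ), E.IsInnerFace (faceAt u j) → (∃ b : Site 2, IsCorner b (faceAt u j) ∧ b ∈ E.zdArcB) → (∀ (ω : BondConfig (Site 2)) (t : ℕ), t < exitTime hE ω → cornerOrbit (E.bcBondConfig ω) (startCorner hE) t = (u, j) → turnCount (E.bcBondConfig ω) (startCorner hE) t = T) → cornerObs E E.δ u (faceAt u j) = Complex.exp (-(Real.pi / 6 * T : ℝ) * I) * touchProb E u := by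
  intro E hE hA1 hB1 u j T hinner hb hT
  rw [cornerObs_eq_phase_mul_real_passes hE hE.delta_pos.ne' hT,
    real_passesCorner_eq_touchProb hE hA1 hB1 (isCorner_faceAt u j) hinner hb]
  rfl

end Summit.CriticalPhenomena.CardyFormulaZ2.Cruxes.ParafermionToSLESixFamilies.PotentialDarbouxPicardDiamond

end
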